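import Summits.Ventures.PercRepro.C026PFunDefs

/-!
# The `K`-part of the (P) functional and `K`-monotonicity (p6, gen 16; mine-3 §26 (a), §30 (1))

`(P_F) = ∑_{ω ⊆ F} N_c(ω)(1 − 2X_c(ω)) + ∑_{ω ⊆ F} K_c(ω)·n̄(ω^c)`: the first sum is `K`-free and the
second is a nonnegative combination of the `K`-products `K_c(ω)`, so `(P)` is nondecreasing in every
`K`-cell (`pFun_mono_K`).  Hence `(P) ≥ 0` at every band state follows from `(P) ≥ 0` at the lower
corners `K = K_min(x)` (`pFun_nonneg_of_corner`, the first step of mine-3's THEOREM C and of THEOREM S).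
-/

namespace PercRepro

namespace MultiGraph

open Finset

variable {V E : Type*} [Fintype V] [DecidableEq V] [Fintype E] [DecidableEq E]
  (G : MultiGraph V E)

/-! ### Bookkeeping of the configuration sums -/

/-- The `K`-free part `∑_{ω ⊆ F} N_c(ω)(1 − 2X_c(ω))` of `(P)`. -/
noncomputable def pFunLin (c : V) (x : V → ℝ) (F : Finset E) : ℝ :=
  ∑ ω ∈ configsIn F, G.nbarOff x c ω * (1 - 2 * G.xCluster x c ω)

/-- The `K`-part `∑_{ω ⊆ F} K_c(ω)·n̄(ω^c)` of `(P)`. -/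
noncomputable def pFunK (c : V) (x K : V → ℝ) (F : Finset E) : ℝ :=
  ∑ ω ∈ configsIn F, G.kCluster K c ω * G.nbar x (complIn F ω)

/-- `(P) = ` its `K`-free part plus its `K`-part. -/
theorem pFun_eq_pFunLin_add_pFunK (c : V) (x K : V → ℝ) (F : Finset E) :
    G.pFun c x K F = G.pFunLin c x F + G.pFunK c x K F := by
  unfold pFun pFunLin pFunK
  rw [← Finset.sum_add_distrib]

/-- The `K`-increment of the `K`-part. -/
theorem pFunK_sub_pFunK (c : V) (x K K₀ : V → ℝ) (F : Finset E) :
    G.pFunK c x K F - G.pFunK c x K₀ F =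
      ∑ ω ∈ configsIn F, (G.kCluster K c ω - G.kCluster K₀ c ω) * G.nbar x (complIn F ω) := by
  unfold pFunK
  rw [← Finset.sum_sub_distrib]
  refine Finset.sum_congr rfl fun ω _ => ?_
  ring

variable {G}

/-- `(P)` is nondecreasing in the `K`-cells (mine-3 §26 (a): affine nondecreasing in every `K`). -/
theorem pFun_mono_K {c : V} {x K K₀ : V → ℝ} (hx : ∀ v, 0 ≤ x v ∧ x v ≤ 1)
    (hK₀ : ∀ v, 0 ≤ K₀ v) (hKK : ∀ v, K₀ v ≤ K v) (F : Finset E) :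
    G.pFun c x K₀ F ≤ G.pFun c x K F := by
  rw [pFun_eq_pFunLin_add_pFunK, pFun_eq_pFunLin_add_pFunK]
  have h : 0 ≤ G.pFunK c x K F - G.pFunK c x K₀ F := by
    rw [pFunK_sub_pFunK]
    exact Finset.sum_nonneg fun ω _ =>
      mul_nonneg (sub_nonneg.2 (kCluster_mono hK₀ hKK c ω)) (nbar_nonneg hx _)
  linarith

/-- **Corner reduction**: if `(P_F) ≥ 0` at every lower-corner state, it holds at every band
state (the first step of mine-3's THEOREM C, §30 (1)). -/
theorem pFun_nonneg_of_corner {c : V} {F : Finset E}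
    (hcorner : ∀ x : V → ℝ, (∀ v, 0 ≤ x v ∧ x v ≤ 1) → 0 ≤ G.pFun c x (fun v => kMin (x v)) F)
    {x K : V → ℝ} (hx : ∀ v, 0 ≤ x v ∧ x v ≤ 1) (hK : ∀ v, kMin (x v) ≤ K v) :
    0 ≤ G.pFun c x K F :=
  (hcorner x hx).trans (pFun_mono_K hx (fun _ => le_max_left _ _) hK F)

end MultiGraph

end PercRepro
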